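import Summits.QuantumFields.YangMills.Theorems.UnitScaleTiltProp7DivSliceRowOfHcompKnit
import Summits.QuantumFields.YangMills.Theorems.UnitScaleTiltProp7DivSqCurvedOfRegPr
import HarnessLib

/-!
# Route `UnitScaleTilt`, crux K1 «MinimiserStabilityRegPr» (stmt-QuantumFields-19200), route-R E′ architecture (A′) «HCOW-VIA-Σ» — **THE (DV) ROW OF THE P-A2 ASSEMBLER IS A
# THEOREM**: the third displayed hypothesis `hV` of ★p1 g18's `Prop7PA2OfSymDiffDivRows.hPA2_of_symL1_diffL1_divSlice` («for every `L > 1`, `B₁′ > 0` there are L-only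
# `eV > 0`, `ζ, δ₁ ≥ 0` with `DIV(W, I•X) ≤ ζ·K + δ₁·ℓ⁻²·M` on the whole `hcoS` binder») holds, BY KERNEL, with no displayed row left: the door
# ✓`Prop7DivSliceRowOfHcompKnit.hV_of_hcompKnit` (px12 g6) fed with px19 g5's HCOMP-KNIT ✓`Prop7DivSqCurvedOfRegPr.div_sq_le_of_isLandauPrint_of_regPr` (p698515).

Cell `ym3-torus`, width seat `ym3-torus-px12` (gen 6; explicit-unit helper, `--supports stmt-QuantumFields-19200 --as helper`, count-neutral; NO claim on crux ∕ stub ∕ registry).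
THEOREMS ONLY (0 `def`, 0 `sorry`).  YM₃ on T³ is a ladder rung (R3), not the Clay problem; nothing here claims `hPA2` (its rows (S) and (β) stay displayed), `hcoS`, (A′), E′, a stub,
the crux, d = 4 or the mass gap.

THE CHAIN, ALL ✓, BY NAME.  px12 g5 ✓p692842 `Prop7DivSqOfCombBernsteinRow.div_sq_le_of_competitorRow` (door: the (a)-orthogonality + F3 member reading) ∘ px19 g5 ✓p698515 (the competitor:
Bałaban's bubble — px11 g5 ✓p694684∕✓p696204 comb averaging of the pullback, px19 ✓p697307 competitor energy at the member ← ✓p691822∕✓p692359 F1-core ⊕ ✓p694353 ⊕ ✓p692893,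
✓p694073 bubble rows ← ✓p692550, px11 ✓p693794∕✓p691350 defect rows, ★w1 g14 ✓`Prop7LandauCombDict`) ∘ px12 g6 ✓p697059 DV-SEAM (member letters → lattice `divB` letters) ∘
px12 g6 ✓`hV_of_hcompKnit` (the L-only radius `eV(L)`, `ζ = 0`, `δ₁ = 2·36⁶∕16·(3 + 27eV²)`).

WHAT IS PROVED (ns `…Theorems.Prop7DivSliceRowHolds`): ★★★ `hV_holds` — the (DV) row, hypothesis-free (the knit read at unit weight; the weight cancels in ✓p697059).
HONEST SCOPE.  One application; every estimate is in the cited files.  Print: the crude slice [Balaban1985RegularSpaces] (1.38) on print's slice [Balaban1985Variational] (21) at a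
printed-regular background, the `dv`-budget of (44)–(47)∕(106)–(111) with `ζ = 0` and an ABSOLUTE `δ₁` (up to the L-only radius in `27eV²`).

References: T. Bałaban, CMP **102** (1985) 277–309 [Balaban1985Variational] ((2), (6) pp.278–279, (21) p.281, (44)–(47) p.286, Prop. 7 p.299); CMP **99** (1985) 75–102
[Balaban1985RegularSpaces] ((1.38) p.82); CMP **99** (1985) 389–434 [Balaban1985BackgroundPropagators] ((3.8), (3.11) p.392); CMP **96** (1984) 223–250 [Balaban1984PropagatorsII]
((2.7)–(2.12) pp.224–225).
-/

set_option autoImplicit false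
noncomputable section

open scoped BigOperators Matrix.Norms.L2Operator Matrix Topology InnerProductSpace
open Filter NormedSpace

namespace Summit.QuantumFields.YangMills.Theorems.Prop7DivSliceRowHolds

open Literature.MathematicalPhysics.QuantumFieldTheory.Balaban1983to89
open Literature.MathematicalPhysics.QuantumFieldTheory.Balaban1983to89.T3ContinuumYM3Torus
open Literature.MathematicalPhysics.QuantumFieldTheory.Balaban1983to89.T3UnitLawDensityEML (ℰp)
open Literature.MathematicalPhysics.QuantumFieldTheory.Balaban1983to89.T3ConstrainedMinimiser (fibre)
open Literature.MathematicalPhysics.QuantumFieldTheory.Balaban1983to89.T3PrintedRegularMinimiser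
open Literature.MathematicalPhysics.QuantumFieldTheory.Balaban1983to89.T3RegularMinimiser
open Literature.MathematicalPhysics.QuantumFieldTheory.Balaban1983to89.T3Thm1Carrier
open T4Continuum BlockAveraging AveragingRT ExpMeanLog BlockAveragingEMLLinearised BlockAveragingEMLLinearisedBackground BlockAveragingEMLProp2
open T3SectALandauChart (In19)
open B10Eq27TorusAxialLog (unitsField toUField)
open B9Eq39Adjoint (divB)
open B9TorusCalculus (torusT)
open Summit.QuantumFields.YangMills.Theorems.Prop7SPrint (AvgCondPrint IsLandauPrint)
open Summit.QuantumFields.YangMills.Theorems.Prop7TPrint (expHermField)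
open Summit.QuantumFields.YangMills.Theorems.Prop7DivSliceRowOfHcompKnit (hV_of_hcompKnit)
open Summit.QuantumFields.YangMills.Theorems.Prop7DivSqCurvedOfRegPr (div_sq_le_of_isLandauPrint_of_regPr)

/-- ★★★ **THE (DV) ROW OF THE P-A2 ASSEMBLER, HYPOTHESIS-FREE**: for every `L > 1`, `B₁′ > 0` there are L-only `eV > 0`, `ζ, δ₁ ≥ 0` such that on the whole `hcoS` binder
(E–L-critical `W ∈ (6)(e) ∩ 𝔅_k(V)`, `0 < e ≤ eV`, Σ-representative `X` with `In19`, `AvgCondPrint`, `IsLandauPrint`)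
`Σ_x Σ_{jk} |(divB_W (I•X))(x)_{jk}|² ≤ ζ·Σ_p‖ℒ_p(iX)‖² + δ₁·((L^{K−n})²)⁻¹·Σ_b‖X b‖²` — the text of `hV` in ✓`Prop7PA2OfSymDiffDivRows.hPA2_of_symL1_diffL1_divSlice`
VERBATIM (no weight appears in it: the member row is read at the unit weight `c₀ := 1`, which cancels in the DV-SEAM); `:= hV_of_hcompKnit 1 ⟨px19's knit⟩`.
[cite: Balaban1985RegularSpaces, (1.38) p.82; Balaban1985Variational, (21) p.281, (44)-(47) p.286, Prop. 7 p.299; Balaban1985BackgroundPropagators, (3.8), (3.11) p.392; Balaban1984PropagatorsII, (2.7)-(2.12) pp.224-225] -/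
theorem hV_holds :
    ∀ (L : ℕ), 1 < L → ∀ (B₁' : ℝ), 0 < B₁' → ∃ eV ζ δ₁ : ℝ, 0 < eV ∧ 0 ≤ ζ ∧ 0 ≤ δ₁ ∧
      ∀ (F : T3Family), F.L = L → ∀ (n K : ℕ) (hnK : n < K) (e : ℝ) (V : GaugeField (F.P n) 0 (Matrix.specialUnitaryGroup (Fin 2) ℂ))
        (W : GaugeField (F.P K) 0 (Matrix.specialUnitaryGroup (Fin 2) ℂ)) (X : PBond (F.P K) 0 → Matrix (Fin 2) (Fin 2) ℂ),
        0 < e → e ≤ eV → W ∈ regFibrePr F n K hnK.le e V →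
        (∀ γ : ℝ → GaugeField (F.P K) 0 (Matrix.specialUnitaryGroup (Fin 2) ℂ), γ 0 = W → (∀ t, γ t ∈ fibre F ℰp n K hnK.le V) →
          (∀ b, DifferentiableAt ℝ (fun t => ((γ t b : Matrix.specialUnitaryGroup (Fin 2) ℂ) : Matrix (Fin 2) (Fin 2) ℂ)) 0) →
            deriv (fun t => wilsonAction4 (γ t)) 0 = 0) →
        In19 F n K (2 * B₁' * e) W (expHermField X) X → AvgCondPrint F n K hnK.le V W X → IsLandauPrint F n K W X →
          (∑ x : Site (F.P K) 0, ∑ j : Fin 2, ∑ k : Fin 2,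
              ‖(divB (torusT (F.P K) 0) (fun κ z => unitsField (toUField W) ⟨z, κ⟩) (fun κ z => Complex.I • X ⟨z, κ⟩) x) j k‖ ^ 2)
              ≤ ζ * (∑ p : Plaq (F.P K) 0, ‖((Complex.I • X ⟨p.src, p.μ⟩) + ((W ⟨p.src, p.μ⟩ : Matrix (Fin 2) (Fin 2) ℂ) * (Complex.I • X ⟨p.src.shift p.μ, p.ν⟩) * star (W ⟨p.src, p.μ⟩ : Matrix (Fin 2) (Fin 2) ℂ))
            - (((W ⟨p.src, p.μ⟩ * W ⟨p.src.shift p.μ, p.ν⟩ * (W ⟨p.src.shift p.ν, p.μ⟩)⁻¹ : Matrix.specialUnitaryGroup (Fin 2) ℂ) : Matrix (Fin 2) (Fin 2) ℂ) * (Complex.I • X ⟨p.src.shift p.ν, p.μ⟩) * star ((W ⟨p.src, p.μ⟩ * W ⟨p.src.shift p.μ, p.ν⟩ * (W ⟨p.src.shift p.ν, p.μ⟩)⁻¹ : Matrix.specialUnitaryGroup (Fin 2) ℂ) : Matrix (Fin 2) (Fin 2) ℂ))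
            - (((GaugeField.plaqHol W p : Matrix.specialUnitaryGroup (Fin 2) ℂ) : Matrix (Fin 2) (Fin 2) ℂ) * (Complex.I • X ⟨p.src, p.ν⟩) * star ((GaugeField.plaqHol W p : Matrix.specialUnitaryGroup (Fin 2) ℂ) : Matrix (Fin 2) (Fin 2) ℂ)))‖ ^ 2) + δ₁ * (((F.L : ℝ) ^ (K - n)) ^ 2)⁻¹ * (∑ b : PBond (F.P K) 0, ‖X b‖ ^ 2) := by
  haveI h1 : ∀ L : ℕ, Fact (0 < (fun _ : ℕ => (1 : ℝ)) L) := fun _ => ⟨one_pos⟩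
  exact hV_of_hcompKnit (fun _ : ℕ => (1 : ℝ)) (fun F n K hnK a W ha h3 h4 hN hreg X hX =>
    div_sq_le_of_isLandauPrint_of_regPr F n K ((fun _ : ℕ => (1 : ℝ)) F.L) ha h3 h4 hN hnK hreg X hX)

end Summit.QuantumFields.YangMills.Theorems.Prop7DivSliceRowHolds

end
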